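import Literature.Analysis.OperatorTheory.YangMillsMatrixModelWeakEigenbasis
import HarnessLib

/-!
# The Kato datum `(V, ι, S)` of Lüscher's form on the invariant core, as NAMED objects

Topic `Literature/Analysis/OperatorTheory`; companion of `YangMillsMatrixModelCoreRellich.lean` /
`YangMillsMatrixModelWeakEigenbasis.lean`, which prove everything below for an ABSTRACT feature map `T` and consume it
inside one proof (`exists_weakEigenbasis_physLevel`).  Consumers other than the weak eigenbasis — notably the simplicity
criterion `Literature.Analysis.UnboundedOperators.sInf_coreLevelSet_zero_lt_one` (discharge of `LuscherSimonGap`) — need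
the datum BY NAME, in exactly the input format of `Literature.Analysis.UnboundedOperators.exists_core_form_eigenseq`
(Kato VI §1.3 / Thm 1.27: a core `V` with the `(𝔮+1)`-inner product, `ι : V →L L²`, `S : V → L²` with
`⟪f, g⟫_V = ⟪S f, ι g⟫ + ⟪ι f, ι g⟫`, Rellich on the core).  This file names it:

* `coreFeatureFun`, `coreFeature : coreSubmodule →ₗ[ℝ] ⨁_{11} L²(ℝ⁹)` — the feature map `ψ ↦ (ψ, √V·ψ, (∂_pψ/√2)_p)`
  (so `‖coreFeature ψ‖² = ‖ψ‖²_{L²} + 𝔮(ψ)`: the form inner product WITHOUT a new instance), its component equations,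
  injectivity;
* `coreSpace = range coreFeature` (the `V`; an inner product space as a submodule of `⨁_{11} L²`),
  `not_finiteDimensional_coreSpace`, `coreInv : coreSpace ≃ₗ coreSubmodule` (the inverse `Ψ`);
* `coreEmbedding : coreSpace →L[ℝ] L²(ℝ⁹)` (the `ι`, first feature) and `coreOp : coreSpace → L²(ℝ⁹)` (the `S = 𝔥`);
* the datum theorems BY NAME: `coreSpace_form_identity` (`hS`), `coreSpace_form_data`, `coreSpace_totallyBounded`
  (Rellich, `htb`), `coreSpace_levelSet` (the Rayleigh sets of `(V, ι)` are the tree's `levelSet (k+1)`, so their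
  infima are `physLevel (k+1)`), `range_coreEmbedding_eq`, `weak_eq_of_coreSpace`.

Definitions + theorems; no named facts, no instances, no notation.  NOT a claim about any gap.

## References
* [Kato1966] T. Kato, *Perturbation Theory for Linear Operators*, VI §1.3 Example 1.8, §1.5 Thm 1.27.
* [ReedSimonIV1978] M. Reed, B. Simon, *Methods of Modern Mathematical Physics IV* (1978), Thm XIII.2, XIII.64–65.
-/

noncomputable section

open MeasureTheory Filter Topology Real
open scoped InnerProductSpace BigOperators

namespace Literature.Analysis.OperatorTheory.YMMatrixModel

/-! ### §1. The feature map -/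

/-- The features of an invariant test function as `L²(ℝ⁹)` classes: index `none ↦ ψ`, `some none ↦ √V·ψ`,
`some (some p) ↦ ∂_pψ/√2`. [cite: Kato1966, VI §1.3 Example 1.8] -/
def coreFeatureFun (f : coreSubmodule) : Option (Option (Fin 3 × Fin 3)) → Lp ℝ 2 (volume : Measure ZM)
  | none => (memLp_two_of_isTestFn f.2.1).toLp _
  | some none => (memLp_two_sqrtPot_of_isTestFn f.2.1).toLp _
  | some (some p) => (memLp_two_const_mul_pderiv_of_isTestFn f.2.1 (Real.sqrt 2)⁻¹ p).toLp _

/-- The features are additive. [cite: Kato1966, VI §1.3 Example 1.8] -/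
theorem coreFeatureFun_add (f g : coreSubmodule) : coreFeatureFun (f + g) = coreFeatureFun f + coreFeatureFun g := by
  funext i
  match i with
  | none =>
    show (memLp_two_of_isTestFn (f + g).2.1).toLp _ =
      (memLp_two_of_isTestFn f.2.1).toLp _ + (memLp_two_of_isTestFn g.2.1).toLp _
    rw [← MemLp.toLp_add]
    exact MemLp.toLp_congr _ _ (Eventually.of_forall fun x => rfl)
  | some none =>
    show (memLp_two_sqrtPot_of_isTestFn (f + g).2.1).toLp _ =
      (memLp_two_sqrtPot_of_isTestFn f.2.1).toLp _ + (memLp_two_sqrtPot_of_isTestFn g.2.1).toLp _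
    rw [← MemLp.toLp_add]
    exact MemLp.toLp_congr _ _ (Eventually.of_forall fun x => by
      simp only [Submodule.coe_add, Pi.add_apply, mul_add])
  | some (some p) =>
    show (memLp_two_const_mul_pderiv_of_isTestFn (f + g).2.1 (Real.sqrt 2)⁻¹ p).toLp _ =
      (memLp_two_const_mul_pderiv_of_isTestFn f.2.1 (Real.sqrt 2)⁻¹ p).toLp _ +
        (memLp_two_const_mul_pderiv_of_isTestFn g.2.1 (Real.sqrt 2)⁻¹ p).toLp _
    rw [← MemLp.toLp_add]
    exact MemLp.toLp_congr _ _ (Eventually.of_forall fun x => by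
      simp only [Submodule.coe_add, Pi.add_apply, pderiv_add f.2.1.differentiable g.2.1.differentiable p, mul_add])

/-- The features are homogeneous. [cite: Kato1966, VI §1.3 Example 1.8] -/
theorem coreFeatureFun_smul (c : ℝ) (f : coreSubmodule) : coreFeatureFun (c • f) = c • coreFeatureFun f := by
  funext i
  match i with
  | none =>
    show (memLp_two_of_isTestFn (c • f).2.1).toLp _ = c • (memLp_two_of_isTestFn f.2.1).toLp _
    rw [← MemLp.toLp_const_smul]
    exact MemLp.toLp_congr _ _ (Eventually.of_forall fun x => rfl)
  | some none =>
    show (memLp_two_sqrtPot_of_isTestFn (c • f).2.1).toLp _ = c • (memLp_two_sqrtPot_of_isTestFn f.2.1).toLp _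
    rw [← MemLp.toLp_const_smul]
    exact MemLp.toLp_congr _ _ (Eventually.of_forall fun x => by
      simp only [Submodule.coe_smul, Pi.smul_apply, smul_eq_mul]; ring)
  | some (some p) =>
    show (memLp_two_const_mul_pderiv_of_isTestFn (c • f).2.1 (Real.sqrt 2)⁻¹ p).toLp _ =
      c • (memLp_two_const_mul_pderiv_of_isTestFn f.2.1 (Real.sqrt 2)⁻¹ p).toLp _
    rw [← MemLp.toLp_const_smul]
    exact MemLp.toLp_congr _ _ (Eventually.of_forall fun x => by
      simp only [Submodule.coe_smul, Pi.smul_apply, smul_eq_mul, pderiv_smul f.2.1.differentiable c p]; ring)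

/-- **The feature map** `ψ ↦ (ψ, √V·ψ, (∂_pψ/√2)_p) ∈ ⨁_{11} L²(ℝ⁹)`, linear on the invariant core: it realises the
`(𝔮+1)`-inner product of the form core as the restriction of the Hilbert-sum inner product (`norm_coreFeature_sq`).
[cite: Kato1966, VI §1.3 Example 1.8] -/
def coreFeature :
    coreSubmodule →ₗ[ℝ] PiLp 2 (fun _ : Option (Option (Fin 3 × Fin 3)) => Lp ℝ 2 (volume : Measure ZM)) where
  toFun f := WithLp.toLp 2 (coreFeatureFun f)
  map_add' f g := by
    show WithLp.toLp 2 (coreFeatureFun (f + g)) = WithLp.toLp 2 (coreFeatureFun f) + WithLp.toLp 2 (coreFeatureFun g)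
    rw [coreFeatureFun_add, WithLp.toLp_add]
  map_smul' c f := by
    show WithLp.toLp 2 (coreFeatureFun (c • f)) = c • WithLp.toLp 2 (coreFeatureFun f)
    rw [coreFeatureFun_smul, WithLp.toLp_smul]

/-- First feature = the function itself (as an `L²` class). [cite: Kato1966, VI §1.3 Example 1.8] -/
theorem coreFeature_apply_none (f : coreSubmodule) : (coreFeature f) none = (memLp_two_of_isTestFn f.2.1).toLp _ := rfl

/-- Second feature = `√V·ψ`. [cite: Kato1966, VI §1.3 Example 1.8] -/
theorem coreFeature_apply_some_none (f : coreSubmodule) :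
    (coreFeature f) (some none) = (memLp_two_sqrtPot_of_isTestFn f.2.1).toLp _ := rfl

/-- The remaining features = `∂_pψ/√2`. [cite: Kato1966, VI §1.3 Example 1.8] -/
theorem coreFeature_apply_some_some (f : coreSubmodule) (p : Fin 3 × Fin 3) :
    (coreFeature f) (some (some p)) = (memLp_two_const_mul_pderiv_of_isTestFn f.2.1 (Real.sqrt 2)⁻¹ p).toLp _ := rfl

/-- Membership proof of the core read as the pair `IsTestFn ∧ IsGaugeInv` (the `hC` of the abstract lemmas).
[cite: ReedSimonIV1978, Thm. XIII.2] -/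
theorem coreSubmodule_mem_spec (f : coreSubmodule) : IsTestFn (f : ZM → ℝ) ∧ IsGaugeInv (f : ZM → ℝ) := f.2

/-- `‖coreFeature ψ‖² = ‖ψ‖²_{L²} + 𝔮(ψ)`. [cite: Kato1966, VI §1.3 Example 1.8] -/
theorem norm_coreFeature_sq (f : coreSubmodule) :
    ‖coreFeature f‖ ^ 2 = l2sq (f : ZM → ℝ) + energyForm (f : ZM → ℝ) :=
  norm_coreMap_sq coreSubmodule_mem_spec coreFeature coreFeature_apply_none coreFeature_apply_some_none
    coreFeature_apply_some_some f

/-- The feature map is injective. [cite: Kato1966, VI §1.3 Example 1.8] -/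
theorem coreFeature_injective : Function.Injective coreFeature :=
  coreMap_injective coreSubmodule_mem_spec coreFeature coreFeature_apply_none

/-! ### §2. The core space `V = coreFeature(C)`, its inverse chart, embedding and operator -/

/-- **The core space `V`**: the image of the invariant core under the feature map, an inner product space as a
submodule of `⨁_{11} L²(ℝ⁹)` (norm² = `‖ψ‖² + 𝔮(ψ)`). [cite: Kato1966, VI §1.3 Example 1.8] -/
abbrev coreSpace :
    Submodule ℝ (PiLp 2 (fun _ : Option (Option (Fin 3 × Fin 3)) => Lp ℝ 2 (volume : Measure ZM))) :=
  LinearMap.range coreFeature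

/-- `V` is infinite-dimensional (it contains the images of the shell functions). [cite: ReedSimonIV1978, Thm. XIII.1] -/
theorem not_finiteDimensional_coreSpace : ¬ FiniteDimensional ℝ coreSpace :=
  not_finiteDimensional_range_coreMap coreSubmodule_mem_spec coreFeature coreFeature_apply_none
    (fun _ h1 h2 => ⟨h1, h2⟩)

/-- The inverse chart `Ψ : V ≃ C` of the feature map. [cite: Kato1966, VI §1.3 Example 1.8] -/
def coreInv : coreSpace ≃ₗ[ℝ] coreSubmodule := (LinearEquiv.ofInjective coreFeature coreFeature_injective).symm

/-- `coreFeature (Ψ v) = v`. [cite: Kato1966, VI §1.3 Example 1.8] -/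
theorem coreFeature_coreInv (v : coreSpace) :
    coreFeature (coreInv v) = (v : PiLp 2 (fun _ : Option (Option (Fin 3 × Fin 3)) => Lp ℝ 2 (volume : Measure ZM))) :=
  LinearEquiv.ofInjective_symm_apply coreFeature (h := coreFeature_injective) v

/-- `Ψ (coreFeature f) = f`. [cite: Kato1966, VI §1.3 Example 1.8] -/
theorem coreInv_coreFeature (f : coreSubmodule) :
    coreInv ⟨coreFeature f, LinearMap.mem_range_self coreFeature f⟩ = f :=
  coreFeature_injective (coreFeature_coreInv ⟨coreFeature f, LinearMap.mem_range_self coreFeature f⟩)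

/-- **The embedding `ι : V →L L²(ℝ⁹)`** (first feature). [cite: Kato1966, VI §1.5 Thm. 1.27] -/
def coreEmbedding : coreSpace →L[ℝ] Lp ℝ 2 (volume : Measure ZM) :=
  (PiLp.proj 2 (𝕜 := ℝ) (fun _ : Option (Option (Fin 3 × Fin 3)) => Lp ℝ 2 (volume : Measure ZM)) none).comp
    coreSpace.subtypeL

/-- `ι v` is the `none` component of `v`. [cite: Kato1966, VI §1.5 Thm. 1.27] -/
theorem coreEmbedding_apply' (v : coreSpace) :
    coreEmbedding v = (v : PiLp 2 (fun _ : Option (Option (Fin 3 × Fin 3)) => Lp ℝ 2 (volume : Measure ZM))) none :=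
  rfl

/-- `ι v` is the `L²` class of the core function `Ψ v`. [cite: Kato1966, VI §1.5 Thm. 1.27] -/
theorem coreEmbedding_apply (v : coreSpace) :
    coreEmbedding v = (memLp_two_of_isTestFn (coreInv v).2.1).toLp _ := by
  have h1 : (coreFeature (coreInv v)) none = (memLp_two_of_isTestFn (coreInv v).2.1).toLp _ :=
    coreFeature_apply_none (coreInv v)
  have h2 : (coreFeature (coreInv v)) none =
      (v : PiLp 2 (fun _ : Option (Option (Fin 3 × Fin 3)) => Lp ℝ 2 (volume : Measure ZM))) none := by
    rw [coreFeature_coreInv v]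
  exact (coreEmbedding_apply' v).trans (h2.symm.trans h1)

/-- **The operator `S = 𝔥` on the core**, `S v = 𝔥(Ψ v)` as an `L²` class. [cite: Kato1966, VI §1.5 Thm. 1.27] -/
def coreOp (v : coreSpace) : Lp ℝ 2 (volume : Measure ZM) := (memLp_two_hApply_of_isTestFn (coreInv v).2.1).toLp _

/-- `coreOp` unfolded. [cite: Kato1966, VI §1.5 Thm. 1.27] -/
theorem coreOp_apply (v : coreSpace) : coreOp v = (memLp_two_hApply_of_isTestFn (coreInv v).2.1).toLp _ := rfl

/-! ### §3. The datum theorems by name -/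

/-- **Kato's identity `⟪v, w⟫_V = ⟪S v, ι w⟫ + ⟪ι v, ι w⟫`** on the core space (the `hS` of `exists_core_form_eigenseq` /
`sInf_coreLevelSet_zero_lt_one`). [cite: Kato1966, VI §1.5 Thm. 1.27] -/
theorem coreSpace_form_identity (v w : coreSpace) :
    ⟪v, w⟫_ℝ = ⟪coreOp v, coreEmbedding w⟫_ℝ + ⟪coreEmbedding v, coreEmbedding w⟫_ℝ :=
  coreMap_form_identity coreSubmodule_mem_spec coreFeature coreFeature_apply_none coreFeature_apply_some_none
    coreFeature_apply_some_some coreInv coreFeature_coreInv coreEmbedding coreEmbedding_apply coreOp coreOp_apply v w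

/-- The form data `𝔮(Ψ v) = ‖v‖² − ‖ι v‖²`, `‖Ψ v‖²_{L²} = ‖ι v‖²`. [cite: ReedSimonIV1978, Thm. XIII.2] -/
theorem coreSpace_form_data (v : coreSpace) :
    energyForm (coreInv v : ZM → ℝ) = ‖v‖ ^ 2 - ‖coreEmbedding v‖ ^ 2 ∧
      l2sq (coreInv v : ZM → ℝ) = ‖coreEmbedding v‖ ^ 2 :=
  coreMap_form_data coreSubmodule_mem_spec coreFeature coreFeature_apply_none coreFeature_apply_some_none
    coreFeature_apply_some_some coreInv coreFeature_coreInv coreEmbedding coreEmbedding_apply' v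

/-- **Rellich on the core space** (the `htb`): `ι` maps norm balls of `V` to totally bounded subsets of `L²(ℝ⁹)`.
[cite: ReedSimonIV1978, Thm. XIII.65] -/
theorem coreSpace_totallyBounded (r : ℝ) :
    TotallyBounded (coreEmbedding '' Metric.closedBall (0 : coreSpace) r) :=
  coreMap_totallyBounded coreSubmodule_mem_spec coreFeature coreInv coreEmbedding coreEmbedding_apply
    coreSpace_form_data r

/-- **The Rayleigh sets of `(V, ι)` are the tree's `levelSet (k+1)`** (so their infima are `physLevel (k+1)`).
[cite: ReedSimonIV1978, Thm. XIII.2] -/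
theorem coreSpace_levelSet (k : ℕ) :
    {s : ℝ | ∃ W : Submodule ℝ coreSpace, Module.finrank ℝ W = k + 1 ∧
      ∀ f ∈ W, ‖f‖ ^ 2 - ‖coreEmbedding f‖ ^ 2 ≤ s * ‖coreEmbedding f‖ ^ 2} = levelSet (k + 1) :=
  coreMap_levelSet coreSubmodule_mem_spec coreFeature (fun _ h1 h2 => ⟨h1, h2⟩) coreInv coreInv_coreFeature
    (coreSubmodule.subtype.comp coreInv.toLinearMap) (fun _ => rfl) coreEmbedding coreSpace_form_data k

/-- The infimum of the `(k+1)`-st Rayleigh set of `(V, ι)` is `physLevel (k+1)`. [cite: ReedSimonIV1978, Thm. XIII.2] -/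
theorem sInf_coreSpace_rayleigh (k : ℕ) :
    sInf {s : ℝ | ∃ W : Submodule ℝ coreSpace, Module.finrank ℝ W = k + 1 ∧
      ∀ f ∈ W, ‖f‖ ^ 2 - ‖coreEmbedding f‖ ^ 2 ≤ s * ‖coreEmbedding f‖ ^ 2} = physLevel (k + 1) := by
  rw [coreSpace_levelSet, physLevel_eq_sInf]

/-- The range of `ι` is the set of `L²` classes of invariant test functions. [cite: ReedSimonIV1978, Thm. XIII.2] -/
theorem range_coreEmbedding_eq :
    Set.range coreEmbedding = {v : Lp ℝ 2 (volume : Measure ZM) |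
      ∃ ψ : ZM → ℝ, IsTestFn ψ ∧ IsGaugeInv ψ ∧ (v : ZM → ℝ) =ᵐ[volume] ψ} :=
  range_coreEmbedding coreSubmodule_mem_spec coreFeature (fun _ h1 h2 => ⟨h1, h2⟩) coreInv coreInv_coreFeature
    coreEmbedding coreEmbedding_apply

/-- Reading a weak eigen-equation `⟪u, S(Tg)⟫ = μ ⟪u, ι(Tg)⟫` on the core space as `∫ u·𝔥g = μ ∫ u·g`.
[cite: ReedSimonIV1978, Thm. XIII.64] -/
theorem weak_eq_of_coreSpace (u : Lp ℝ 2 (volume : Measure ZM)) (μ : ℝ) {g : ZM → ℝ} (hg : IsTestFn g)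
    (hgg : IsGaugeInv g)
    (h : ⟪u, coreOp ⟨coreFeature ⟨g, ⟨hg, hgg⟩⟩, LinearMap.mem_range_self coreFeature _⟩⟫_ℝ =
      μ * ⟪u, coreEmbedding ⟨coreFeature ⟨g, ⟨hg, hgg⟩⟩, LinearMap.mem_range_self coreFeature _⟩⟫_ℝ) :
    ∫ x, u x * hApply g x = μ * ∫ x, u x * g x :=
  weak_eq_of_core coreSubmodule_mem_spec coreFeature (fun _ h1 h2 => ⟨h1, h2⟩) coreInv coreInv_coreFeature
    coreEmbedding coreEmbedding_apply coreOp coreOp_apply u μ hg hgg h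

end Literature.Analysis.OperatorTheory.YMMatrixModel

end
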